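import Summits.Ventures.HodgeRepro.TwistedQuadIICore

/-!
# Theorem T sub-case (ii), `ε = −`: the model `(ℤ/2k × ℤ/2) ⋊ ℤ/2` with `s = −1`, in coordinates

Blind re-derivation cell `pub-hodge-repro`, seat `p1` (gen 12).  The sign `s = 2k − 1 = −1` on `ℤ/2k` (odd, square
one), the model `HN k` of `TwistedQuadIICore` for it, the coordinate rules `mkN a e 0 · mkN b f h`, `mkN a e 1 · mkN b f h`,
the four twists `1, u, v, vu` and their inverses in coordinates, `p · c`, the value arithmetic `(a ± 1).val` in `ℤ/2k`,
and the four neighbours `p t_i⁻¹` of every point `p = mkN a e g` — the set `{mkN a e 0, mkN a e 1, mkN (a − 1) e 0,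
mkN (a + 1) (e + 1) 1}` for both `g`.  Pattern-independent; the family and the theorem are in `TwistedQuadIINeg`.
-/

set_option autoImplicit false

open Finset Multiplicative
open scoped Pointwise

namespace HodgeRepro.TwistedQuadIIGen

open HodgeRepro.CosetQuad

variable (k : ℕ) [NeZero k]

/-! ### The sign `s = −1` on `ℤ/2k` -/

omit [NeZero k] in
/-- `2 ∣ 2k`. -/
theorem hm2 : 2 ∣ 2 * k := dvd_mul_right 2 k

/-- `1 ≤ k`. -/
theorem one_le_k : 1 ≤ k := Nat.pos_of_ne_zero (NeZero.ne k)

/-- `s = 2k − 1 = −1`. -/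
def sN : ZMod (2 * k) := ((2 * k - 1 : ℕ) : ZMod (2 * k))

omit [NeZero k] in
/-- `((2k : ℕ) : ℤ/2k) = 0`. -/
theorem two_k_cast : ((2 * k : ℕ) : ZMod (2 * k)) = 0 := ZMod.natCast_self _

/-- `s + 1 = 0`. -/
theorem sN_add_one : sN k + 1 = 0 := by
  have hk := one_le_k k
  rw [sN, ← Nat.cast_succ, Nat.succ_eq_add_one, show 2 * k - 1 + 1 = 2 * k by omega, two_k_cast]

/-- `s = −1`. -/
theorem sN_eq_neg_one : sN k = -1 := eq_neg_of_add_eq_zero_left (sN_add_one k)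

/-- `s² = 1`. -/
theorem sN_sq : sN k * sN k = 1 := by rw [sN_eq_neg_one, neg_mul_neg, one_mul]

/-- `s.val = 2k − 1`. -/
theorem sN_val : (sN k).val = 2 * k - 1 := by
  have hk := one_le_k k
  rw [sN, ZMod.val_natCast_of_lt (by omega)]

/-- `s` is odd. -/
theorem sN_odd : (sN k).val % 2 = 1 := by
  have hk := one_le_k k
  rw [sN_val]; omega

/-- The model for `ε = −`. -/
abbrev HN : Type := HGen (2 * k) (hm2 k) (sN k) (sN_sq k) (sN_odd k)

/-- Coordinates on `HN`. -/
abbrev mkN (a : ZMod (2 * k)) (e g : ZMod 2) : HN k := mkII (2 * k) (hm2 k) (sN k) (sN_sq k) (sN_odd k) a e g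

/-! ### Coordinates -/

/-- `1 = mkN 0 0 0`. -/
theorem one_eq_mkN : (1 : HN k) = mkN k 0 0 0 := rfl

/-- Multiplication by a `⟨v, c⟩`-point. -/
theorem mkN_mul_zero (a b : ZMod (2 * k)) (e f h : ZMod 2) :
    mkN k a e 0 * mkN k b f h = mkN k (a + b) (e + f) h := by
  refine SemidirectProduct.ext ?_ ?_
  · show (ofAdd a, ofAdd e) * (phiII (2 * k) (hm2 k) (sN k) (sN_sq k) (sN_odd k) (ofAdd 0)) (ofAdd b, ofAdd f) =
      (ofAdd (a + b), ofAdd (e + f))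
    rw [phiII_zero, MulAut.one_apply, Prod.mk_mul_mk, ← ofAdd_add, ← ofAdd_add]
  · show ofAdd (0 : ZMod 2) * ofAdd h = ofAdd h
    rw [← ofAdd_add, zero_add]

/-- Multiplication by a `u`-coset point. -/
theorem mkN_mul_one (a b : ZMod (2 * k)) (e f h : ZMod 2) :
    mkN k a e 1 * mkN k b f h = mkN k (a + sN k * b) (e + (par (2 * k) b + f)) (1 + h) := by
  refine SemidirectProduct.ext ?_ ?_
  · show (ofAdd a, ofAdd e) * (phiII (2 * k) (hm2 k) (sN k) (sN_sq k) (sN_odd k) (ofAdd 1)) (ofAdd b, ofAdd f) =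
      (ofAdd (a + sN k * b), ofAdd (e + (par (2 * k) b + f)))
    rw [phiII_one, tauII_apply, tauFun, toAdd_ofAdd, toAdd_ofAdd, Prod.mk_mul_mk, ← ofAdd_add, ← ofAdd_add]
  · show ofAdd (1 : ZMod 2) * ofAdd h = ofAdd (1 + h)
    rw [← ofAdd_add]

omit [NeZero k] in
/-- `par 0 = 0`. -/
theorem par_zero : par (2 * k) 0 = 0 := by rw [par, ZMod.val_zero, Nat.cast_zero]

/-- `par 1 = 1`. -/
theorem par_one : par (2 * k) 1 = 1 := by
  haveI : Fact (1 < 2 * k) := ⟨by have := one_le_k k; omega⟩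
  rw [par, ZMod.val_one, Nat.cast_one]

/-- `par (−1) = 1`. -/
theorem par_neg_one : par (2 * k) (-1) = 1 := by
  have hk := one_le_k k
  rw [← sN_eq_neg_one, par, sN_val, ← ZMod.natCast_mod, show (2 * k - 1) % 2 = 1 by omega, Nat.cast_one]

/-- `(1 : ℤ/2) + 1 = 0`. -/
theorem two_zmod_two' : (1 : ZMod 2) + 1 = 0 := by decide

/-- The four twists in coordinates. -/
theorem rectT_eq :
    rectTII (2 * k) (hm2 k) (sN k) (sN_sq k) (sN_odd k) 0 = mkN k 0 0 0 ∧
    rectTII (2 * k) (hm2 k) (sN k) (sN_sq k) (sN_odd k) 1 = mkN k 0 0 1 ∧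
    rectTII (2 * k) (hm2 k) (sN k) (sN_sq k) (sN_odd k) 2 = mkN k 1 0 0 ∧
    rectTII (2 * k) (hm2 k) (sN k) (sN_sq k) (sN_odd k) 3 = mkN k 1 0 1 := by
  refine ⟨rfl, rfl, rfl, ?_⟩
  show vII (2 * k) (hm2 k) (sN k) (sN_sq k) (sN_odd k) * uII (2 * k) (hm2 k) (sN k) (sN_sq k) (sN_odd k) = mkN k 1 0 1
  rw [vII, uII, mkN_mul_zero, add_zero, add_zero]

/-- The inverses of the four twists: `1, u, v⁻¹ = mkN (−1) 0 0, (vu)⁻¹ = mkN 1 1 1`. -/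
theorem rectT_inv :
    (rectTII (2 * k) (hm2 k) (sN k) (sN_sq k) (sN_odd k) 0)⁻¹ = mkN k 0 0 0 ∧
    (rectTII (2 * k) (hm2 k) (sN k) (sN_sq k) (sN_odd k) 1)⁻¹ = mkN k 0 0 1 ∧
    (rectTII (2 * k) (hm2 k) (sN k) (sN_sq k) (sN_odd k) 2)⁻¹ = mkN k (-1) 0 0 ∧
    (rectTII (2 * k) (hm2 k) (sN k) (sN_sq k) (sN_odd k) 3)⁻¹ = mkN k 1 1 1 := by
  obtain ⟨r0, r1, r2, r3⟩ := rectT_eq k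
  refine ⟨?_, ?_, ?_, ?_⟩
  · rw [r0, ← one_eq_mkN, inv_one]
  · rw [r1]
    apply inv_eq_of_mul_eq_one_right
    rw [mkN_mul_one, mul_zero, add_zero, par_zero, add_zero, add_zero, two_zmod_two', one_eq_mkN]
  · rw [r2]
    apply inv_eq_of_mul_eq_one_right
    rw [mkN_mul_zero, add_neg_cancel, add_zero, one_eq_mkN]
  · rw [r3]
    apply inv_eq_of_mul_eq_one_right
    rw [mkN_mul_one, mul_one, par_one, zero_add, two_zmod_two', add_comm (1 : ZMod (2 * k)), sN_add_one,
      one_eq_mkN]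

/-- `c = mkN 0 1 0`, and `p c` in coordinates. -/
theorem mkN_mul_c (a : ZMod (2 * k)) (e g : ZMod 2) :
    mkN k a e g * cII (2 * k) (hm2 k) (sN k) (sN_sq k) (sN_odd k) = mkN k a (e + 1) g := by
  rcases (show ∀ y : ZMod 2, y = 0 ∨ y = 1 by decide) g with rfl | rfl
  · show mkN k a e 0 * mkN k 0 1 0 = mkN k a (e + 1) 0
    rw [mkN_mul_zero, add_zero]
  · show mkN k a e 1 * mkN k 0 1 0 = mkN k a (e + 1) 1
    rw [mkN_mul_one, mul_zero, add_zero, par_zero, zero_add, add_zero]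

/-! ### Value arithmetic in `ℤ/2k` -/

/-- `(a + 1).val`. -/
theorem val_add_one (a : ZMod (2 * k)) :
    (a + 1).val = if a.val + 1 < 2 * k then a.val + 1 else 0 := by
  haveI : Fact (1 < 2 * k) := ⟨by have := one_le_k k; omega⟩
  have hv : a.val < 2 * k := ZMod.val_lt a
  rw [ZMod.val_add, ZMod.val_one]
  split_ifs with h
  · exact Nat.mod_eq_of_lt h
  · rw [show a.val + 1 = 2 * k by omega, Nat.mod_self]

/-- `(a − 1).val`. -/
theorem val_sub_one (a : ZMod (2 * k)) :
    (a - 1).val = if a.val = 0 then 2 * k - 1 else a.val - 1 := by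
  have hk := one_le_k k
  have hv : a.val < 2 * k := ZMod.val_lt a
  rw [sub_eq_add_neg, ← sN_eq_neg_one, ZMod.val_add, sN_val]
  split_ifs with h
  · rw [h, zero_add, Nat.mod_eq_of_lt (by omega)]
  · rw [show a.val + (2 * k - 1) = (a.val - 1) + 1 * (2 * k) by omega, Nat.add_mul_mod_self_right,
      Nat.mod_eq_of_lt (by omega)]

/-! ### The four neighbours -/

/-- The membership of the four neighbours `p t_i⁻¹` of `p = mkN a e g`, as a set: `{mkN a e 0, mkN a e 1,
mkN (a − 1) e 0, mkN (a + 1) (e + 1) 1}` (in the order `0, 1, 2, 3` for `g = 0` and `1, 0, 3, 2` for `g = 1`). -/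
theorem nbrs_zero (a : ZMod (2 * k)) (e : ZMod 2) :
    mkN k a e 0 * (rectTII (2 * k) (hm2 k) (sN k) (sN_sq k) (sN_odd k) 0)⁻¹ = mkN k a e 0 ∧
    mkN k a e 0 * (rectTII (2 * k) (hm2 k) (sN k) (sN_sq k) (sN_odd k) 1)⁻¹ = mkN k a e 1 ∧
    mkN k a e 0 * (rectTII (2 * k) (hm2 k) (sN k) (sN_sq k) (sN_odd k) 2)⁻¹ = mkN k (a - 1) e 0 ∧
    mkN k a e 0 * (rectTII (2 * k) (hm2 k) (sN k) (sN_sq k) (sN_odd k) 3)⁻¹ = mkN k (a + 1) (e + 1) 1 := by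
  obtain ⟨i0, i1, i2, i3⟩ := rectT_inv k
  refine ⟨?_, ?_, ?_, ?_⟩
  · rw [i0, mkN_mul_zero, add_zero, add_zero]
  · rw [i1, mkN_mul_zero, add_zero, add_zero]
  · rw [i2, mkN_mul_zero, add_zero, sub_eq_add_neg]
  · rw [i3, mkN_mul_zero]

/-- The same for `g = 1`. -/
theorem nbrs_one (a : ZMod (2 * k)) (e : ZMod 2) :
    mkN k a e 1 * (rectTII (2 * k) (hm2 k) (sN k) (sN_sq k) (sN_odd k) 0)⁻¹ = mkN k a e 1 ∧
    mkN k a e 1 * (rectTII (2 * k) (hm2 k) (sN k) (sN_sq k) (sN_odd k) 1)⁻¹ = mkN k a e 0 ∧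
    mkN k a e 1 * (rectTII (2 * k) (hm2 k) (sN k) (sN_sq k) (sN_odd k) 2)⁻¹ = mkN k (a + 1) (e + 1) 1 ∧
    mkN k a e 1 * (rectTII (2 * k) (hm2 k) (sN k) (sN_sq k) (sN_odd k) 3)⁻¹ = mkN k (a - 1) e 0 := by
  obtain ⟨i0, i1, i2, i3⟩ := rectT_inv k
  refine ⟨?_, ?_, ?_, ?_⟩
  · rw [i0, mkN_mul_one, mul_zero, add_zero, par_zero, add_zero, add_zero, add_zero]
  · rw [i1, mkN_mul_one, mul_zero, add_zero, par_zero, add_zero, add_zero, two_zmod_two']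
  · have hs1 : sN k * (-1) = 1 := by rw [mul_neg_one, sN_eq_neg_one, neg_neg]
    rw [i2, mkN_mul_one, hs1, par_neg_one, add_zero]
  · have hs2 : sN k * 1 = -1 := by rw [mul_one, sN_eq_neg_one]
    rw [i3, mkN_mul_one, hs2, ← sub_eq_add_neg, par_one, two_zmod_two', add_zero]

end HodgeRepro.TwistedQuadIIGen
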